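import Mathlib
import HarnessLib
import HarnessLib.Audit
import Summits.AtomisticToContinuum.Statement
import Literature.MathematicalPhysics.KineticTheory.LangevinChainKernel
import Literature.MathematicalPhysics.KineticTheory.LangevinChainGibbs
import Literature.MathematicalPhysics.KineticTheory.LangevinChainNESSHolds
import Summits.AtomisticToContinuum.FouriersLaw.Theorems.EmbeddedDrudeMourreNessUnique
import HarnessLib.Audit.Status.Attr

/-!
Route: BoundaryEscapeDeficit

DORMANT since 2026-08-24T07:54:37Z (reconciler: no traction for 6.6 d (last activity item-evidence-added at 2026-08-17T16:52:55Z); parked, not closed — `ledger route dormant route-AtomisticToContinuum-BoundaryEscapeDeficit --off` to rea) — unstaffed, not closed; items shared with open routes are served there. `ledger route dormant <id> --off` reactivates.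

# Route BoundaryEscapeDeficit — Fourier's law as the escape deficit of one boundary observable —
t^(-1/2) half-line tail + diffusive crossover

Realises idea card AtomisticToContinuum/FouriersLaw/escape-deficit-boundary-tail ("conductance =
zero-frequency noise depression of the boundary kinetic energy"); conforming re-opening of the
retired route EscapeDeficit (retired only because its assembly spelled the Literature decl instead
of the sub-problem Statement; statements audited twice, 11/11 rc0). X_b (BOUNDARY FORM OF FOURIER'S
LAW) = (R) ∧ (E). For P = pinnedChain ω₂ lam β γ (all > 0) and T > 0 let K_N(u) := ∫ (p_0² − T) ·
P_u^{N,T,T}(p_0² − T) dμ_T^N be the equilibrium autocorrelation of the boundary kinetic energy b =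
p_0² of the N-site chain with BOTH Langevin baths at T (μ_T^N = OscillatorChain.gibbsMeasure, P_u =
the CONSTRUCTED kernel OscillatorChain.transitionKernel P N T T u), θ_N(t) := (γ/T²)∫_0^t K_N the
boundary thermalisation curve (first-order response of ⟨p_0²⟩_t to a step of the left bath
temperature: ∂_{T_L}L = γ∂²_{p_0} and Gaussian integration by parts), E_N := 1 − θ_N(∞) the ESCAPE
DEFICIT. (R) ResponseIdentity: under weak-NESS uniqueness the BLR coefficient D_N(T) = lim_{δ→0}
totalCurrent(μ_{N,T+δ/2,T−δ/2})/δ exists and equals (N−1)·γ·E_N (J̃ = γ(T_L − ⟨p_0²⟩), reflection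
symmetry removes the cross kernel via the sum-to-one identity). (E) EscapeLaw: (N−1)·γ·E_N → κ_b(T)
∈ (0, ∞) — "the conductance is what fails to come back". (E) is produced in the second layer from
ONE scalar function of finite equilibrium chains and its eventually-in-M shadow (no infinite-volume
dynamics posited): HalfChainTailLaw (c/√t ≤ 1 − θ_∞(t) ≤ C/√t: complete boundary thermalisation of
the half-line at the first-return rate of 1-D diffusion, the √|ω| cusp of the boundary noise
spectrum), DiffusiveCrossover (E_N comparable to what the half-line still retains at times ≍ N²) and
EscapeNonOscillation (bare existence of the limit in [−∞, ∞], so both tail bounds stay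
load-bearing). With NessUnique and the LANDED existence theorem pinnedChain_exists_isSteadyState,
(R) ∧ (E) give FouriersLawFor (pinnedChain …) with κ = κ_b, i.e. the sub-problem Statement
`FouriersLaw` — the deciding theorem `closes (NessUnique) (ResponseIdentity) (HalfChainTailLaw)
(DiffusiveCrossover) (EscapeNonOscillation) : FouriersLaw` is PROVED in glue.lean (rc0, axioms
propext/choice/Quot.sound; the Tail+Crossover+NonOscillation ⇒ EscapeLaw mesh is inlined).
Lean: `∀ ω₂ lam β γ : ℝ, 0 < ω₂ → 0 < lam → 0 < β → 0 < γ → ∀ T : ℝ, 0 < T → (let P :=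
Literature.MathematicalPhysics.KineticTheory.HeatConduction.pinnedChain ω₂ lam β γ; let K : ℕ → ℝ →
ℝ := fun N u => if h : 0 < N then ∫ z, ((z.2 ⟨0, h⟩) ^ 2 - T) * (∫ y, ((y.2 ⟨0, h⟩) ^ 2 - T)
∂(P.transitionKernel N T T u.toNNReal z)) ∂(P.gibbsMeasure N T) else 0; let E : ℕ → ℝ := fun N => 1
- γ / T ^ 2 * ∫ u in Set.Ioi (0 : ℝ), K N u; ∃ κb : ℝ, 0 < κb ∧ Filter.Tendsto (fun N : ℕ => ((N :
ℝ) - 1) * γ * E N) Filter.atTop (nhds κb))`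

## Assembly
PROVED glue (glue.lean `closes`, ~110 lines, lean check rc0, 0 sorries, axioms
propext/Classical.choice/Quot.sound): fix parameters; clause (i) of FouriersLawFor from the landed
`Literature.MathematicalPhysics.KineticTheory.HeatConduction.pinnedChain_exists_isSteadyState` (all
N, N = 0 included) + NessUnique. Clause (ii): the inlined mesh (Tail at a₁N², a₀N², Crossover, one
common witness M, EReal squeeze) gives EscapeLaw; κ T := κ_b(T) for T > 0 (1 otherwise); for a
steady-state family μ, D N := limUnder over 𝓝[≠] 0 of the response quotient — it IS the quotient's
limit (N = 0: totalCurrent_zero; N ≥ 1: ResponseIdentity) and D N = (N−1)γE_N for N ≥ 1 by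
uniqueness of limits, so D → κ_b(T) (Tendsto.congr'). The `let`-bound K, θ, E are syntactically
identical across decls (zeta-reduced by `dsimp only`). The Assembly item below is the curried type
of `closes`.

Rationale: WHY THIS LINE. BLR's limit (BonettoLebowitzReyBellet2000 §5.3 (33)) takes δT → 0 first, so
everything is EQUILIBRIUM dynamics of finite Langevin chains; the card moves the whole N-dependence
onto one scalar time series at the best-controlled site of the theory, the thermostatted one (OU
structure, hypoelliptic smoothing, Lyapunov control: Carmona2007, CuneoEckmannHairerReyBellet2018
Thm 2.13; kernels, Gibbs state and exponential ergodicity are CONSTRUCTED/PROVED in tree: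
LangevinChainKernel/Gibbs/NESSHolds). Imported from probability/potential theory: first-return
exponents (∫_t^∞ K ≍ t^{-1/2} is the gambler's-ruin tail seen through an absorbing boundary) and
parabolic comparison; the dictionary is an identity, not an analogy: conductance G_N = γE_N =
γ²T⁻²∫(K_∞ − K_N) (KunduDharNarayan2009 open-system response formula, arXiv:0809.4543, + half-line
comparison); continuum shadow = half-space effusivity law and the EMD contact-kernel plateau
(BarratChiaruttini2003, doi:10.1080/0026897031000068578); stochastic shadow = SSEP on the half-line
with one reservoir (SharmaEtAl2026, arXiv:2405.00654). What it does that the six open FouriersLaw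
routes do not: no Green–Kubo of the closed infinite chain (FourierGreenKubo, KineticCorner,
CurrentTiltQuench, PorousMediumCorner need InfiniteChainDynamics + a κ = κ_GK identification), no
entropy/uncertainty bound (BondHeatUncertainty, OddSectorIrreversibility give inequalities): a
two-sided Ohmic bracket c ≤ (N−1)γE_N ≤ C from a tail EXPONENT of one boundary observable,
limit-existence isolated as a bare non-oscillation slot. Negatives index: no FouriersLaw statement
refuted so far (6 negatives in the summit, none here).

RANKED CRUXES. #0 EscapeLaw (target) — THE ESCAPE LAW X_b(E): for all parameters > 0 and T > 0 there
is κ_b(T) > 0 with (N−1)·γ·E_N → κ_b(T), E_N = 1 − (γ/T²)∫_0^∞ K_N the escape deficit of the N-chain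
(notation of § Thesis). Follows from HalfChainTailLaw + DiffusiveCrossover + EscapeNonOscillation
(support EscapeLawOfCruxes; the argument is also inlined in `closes`); with NessUnique +
ResponseIdentity it gives FouriersLaw with κ = κ_b. (why it might fail: Inherits Tail, Crossover and
the non-oscillation slot; κ_b > 0 finite is exactly normal conduction of the pinned anharmonic
chain, open for every deterministic anharmonic bulk (BLR2000 §6.3).) [BonettoLebowitzReyBellet2000,
KunduDharNarayan2009, arXiv:0809.4543]
#2 HalfChainTailLaw (crux) — HALF-LINE BOUNDARY TAIL LAW (card: TAIL). ∃ c, C, t₀ > 0: for every t ≥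
t₀, eventually in the length M, c/√t ≤ 1 − θ_M(t) ≤ C/√t, θ_M(t) = (γ/T²)∫_0^t K_M. Reading: 1 −
θ_∞(t) = J(t)/(γδ) is the normalised energy inflow still entering a half-infinite chain a time t
after its single bath was raised by δ. Upper = complete boundary thermalisation (sum rule
(γ/T²)∫_0^∞ K_∞ = 1: no ballistic channel — FALSE for the harmonic chain) at no slower than the
diffusive rate; lower = energy not carried away faster than diffusively (first-return exponent; √|ω|
cusp of S_b at 0, S_b(0) = 2T²/γ). Shadows: Robin half-space 1 − θ(0,t) ≈ √(κc_v/π)/(γ√t); SSEP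
half-line with one reservoir. [difficulty: open-problem] (why it might fail: Two-sided diffusive law
for one boundary scalar of a Hamiltonian half-line at all T>0: upper = diffusive spreading bound
(exists for no anharmonic chain, BLR2000 §6.3), lower = no superdiffusive escape; as T→0
near-harmonic (θ_∞(∞)<1, RLL1967): c,C,t₀ degenerate; breathers may trap energy.)
[BonettoLebowitzReyBellet2000, RiederLebowitzLieb1967, Nakazawa1970, LepriLiviPoliti2003, Dhar2008,
arXiv:2510.20003, arXiv:2405.00654]
#3 DiffusiveCrossover (crux) — DIFFUSIVE CROSSOVER (card: CROSSOVER, made well-posed). ∃ a₀, a₁, c₂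
> 0, C₂: for all large N, eventually in M, c₂(1 − θ_M(a₁N²)) ≤ E_N ≤ C₂(1 − θ_M(a₀N²)). Reading: by
the sum rule E_N = (γ/T²)∫_0^∞(K_∞ − K_N) is the part of a spontaneous boundary energy fluctuation
that, in the N-chain, leaves through the FAR bath instead of returning; the claim: it is comparable
to what the half-line still retains at times ≍ N². With HalfChainTailLaw at t = a_iN²: c ≤ N·E_N ≤ C
(bounded response AND an Ohmic lower bound). [deps: HalfChainTailLaw] [difficulty: open-problem]
(why it might fail: Needs the far bath invisible at site 0 before the diffusive time to O(1/N),
saturation after it (decay rate ≳1/N² of ONE autocorrelation; the harmonic L²-gap is N⁻³,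
Becker–Menegaki 2022) and sign control of K_N at kinetic times — all beyond the light cone N/v.)
[BeckerMenegaki2022, KunduDharNarayan2009, BarratChiaruttini2003, BonettoLebowitzReyBellet2000,
ButtaEtAl2007, Dhar2008]
#4 ResponseIdentity (crux) — RESPONSE IDENTITY D_N = (N−1)·γ·E_N (card: ResponseIdentities).
Parameters > 0; ASSUMING uniqueness of weak steady states (hypothesis = NessUnique): for every
steady-state family μ, T > 0, N ≥ 1, K_N ∈ L¹(0,∞) and totalCurrent(μ N (T+δ/2) (T−δ/2))/δ →
(N−1)γE_N as δ → 0, δ ≠ 0 (existence AND value; N = 1: both sides 0). Derivation (re-derived by two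
refuter reviews): totalCurrent = (N−1)J̃; J̃ = γ(T_L − ⟨p_0²⟩_μ); response of ⟨p_0²⟩ by Gaussian
integration by parts ∂_{T_b}L = γ∂²_{p_b}, ∫∂²_{p_b}f dμ_T = T⁻²∫f(p_b² − T)dμ_T; for the symmetric
driving the cross kernel is E_N by the sum-to-one identity (equal-temperature shift keeps Gibbs):
dJ̃/dδ = γE_N. Real content: finite-N linear response at equilibrium for the hypoelliptic chain;
Gibbs invariance of the constructed kernels; K_N ∈ L¹ from the proved exponential ergodicity. [deps:
NessUnique, BoundaryKernelBasics] [difficulty: L] (why it might fail: Finite-N linear response at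
equilibrium (δ-differentiability of the NESS current) is unproved for the Langevin pinned chain
(Hairer–Majda 2009 Assumption 5 fails; item 0717 open); also needs Gibbs = invariant law of the
constructed kernels and J̃=γ(T_L−⟨p_0²⟩) in the weak class.) [KunduDharNarayan2009, arXiv:0809.4543,
ReyBellet2003, arXiv:0909.4313, BonettoLebowitzReyBellet2000, CuneoEckmannHairerReyBellet2018]
#5 EscapeNonOscillation (crux) — NON-OSCILLATION OF THE ESCAPE DEFICIT (import slot, lowest rank):
the real sequence (N−1)·γ·E_N has a limit in EReal = [−∞, ∞] (liminf = limsup; no value claimed) —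
the minimal 'existence of the limit' ingredient of BLR (33) that the boundary mechanism does not
produce by itself (Tail + Crossover give only c ≤ (N−1)γE_N ≤ C); stated in EReal so that BOTH
halves of the bracket stay load-bearing (for the harmonic chain it holds with limit ⊤ while
Tail-upper fails). Expected engines: quasi-subadditivity of the resistance 1/(γE_N) (card
fekete-resistance-subadditivity) or monotone saturation of N ↦ N·E_N. Provers of THIS route should
not start here. [difficulty: L] (why it might fail: Bare regularity of N↦(N−1)γE_N; expected from
resistance quasi-subadditivity (fekete card) or monotone saturation, neither proved;
parity/commensurability oscillations of the conductance in N at low T (near-integrable corner) would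
refute it while the Ohmic bracket survives.) [BonettoLebowitzReyBellet2000, arXiv:2310.13338,
CanestrariLiveraniOlla2026]
#9 NessUnique (support) — UNIQUENESS OF THE WEAK STEADY STATE (shared item
stmt-AtomisticToContinuum-0741 of
FourierGreenKubo/KineticCorner/OddSectorIrreversibility/CurrentTiltQuench, identical signature): for
pinnedChain ω₂ lam β γ (all > 0), every N and T_L, T_R > 0, any two measures in the weak
Fokker–Planck class IsSteadyState coincide. Print: uniqueness of the invariant measure
(CuneoEckmannHairerReyBellet2018 Thm 2.13(1); Carmona2007) + the FP-identification lemma (weak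
stationary solution ⇒ P_t-invariant). With the landed pinnedChain_exists_isSteadyState it gives
clause (i) of FouriersLawFor inside `closes`. [difficulty: L] [CuneoEckmannHairerReyBellet2018,
Carmona2007]
#9 BoundaryKernelBasics (support) — BASICS OF THE BOUNDARY KERNEL at fixed N ≥ 1, T > 0 (warm-up
that de-junks θ and E): (a) the Gibbs measure is invariant for the constructed kernels at equal bath
temperatures, (gibbsMeasure N T).bind (transitionKernel N T T t) = gibbsMeasure N T (weak
stationarity pinnedChain_isSteadyState_gibbsMeasure is proved; kernel invariance is Dynkin +
forward-equation uniqueness, or Itô on the pathwise solution); (b) u ↦ K_N(u) continuous; (c)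
|K_N(u)| ≤ 2T² = Var(p_0²); (d) |K_N(u)| ≤ C e^{−cu} from the proved exponential ergodicity; (e)
hence K_N ∈ L¹(0,∞). [difficulty: M] [CuneoEckmannHairerReyBellet2018]
#9 HalfChainLocality (support) — EXISTENCE OF THE HALF-LINE BOUNDARY CURVE θ_∞(t) := lim_{M→∞}
θ_M(t) for every t ≥ 0 (makes 'half-infinite chain with one bath' an honest object; NOT used by
`closes`, whose cruxes are stated eventually-in-M): finite-time locality of the Langevin/Hamiltonian
dynamics with quartic forces (Marchioro–Pellegrinotti–Pulvirenti type bounds, ButtaEtAl2007) +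
convergence of the 1-D Gibbs marginals near site 0 as M → ∞ (transfer-operator gap) + |K_M| ≤ 2T²
for dominated convergence in u. [difficulty: M] [ButtaEtAl2007, LanfordLebowitzLieb1977]
#9 SumRule (support) — SUM RULE / complete boundary thermalisation of the half-line (milestone ⊂
HalfChainTailLaw-upper; the route's CHEAPEST KILL TEST): ∀ ε > 0 ∃ t₀ ∀ t ≥ t₀, eventually in M, |1
− θ_M(t)| ≤ ε, i.e. lim_t lim_M θ_M(t) = 1 = (γ/T²)∫_0^∞ K_∞: a half-infinite chain whose single
bath is raised by δ eventually shows ⟨p_0²⟩ = T + δ to first order ⇔ no ballistic channel. FALSE for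
the harmonic chain (permanent inflow into a perfect phonon sink: the orders lim_t, lim_M do not
commute), so lam, β > 0 must enter here. [difficulty: L] [RiederLebowitzLieb1967, Nakazawa1970,
Mazur1969, LepriLiviPoliti2003]
#9 EscapeLawOfCruxes (support) — MESH of the second layer (provable now — a sorry-free proof
`escapeLawOfCruxes_holds` exists in the planner's Sketch2.lean and the same argument is inlined in
`closes`): Tail at t = a₁N², a₀N² and Crossover (pick one common witness M of the three `∀ᶠ M`
filters) bracket γc₂c/(2√a₁) ≤ (N−1)γE_N ≤ γ·max(C₂,0)·C/√a₀ for large N; the EReal limit is then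
real and positive (ge_of_tendsto/le_of_tendsto, EReal.coe_toReal, EReal.tendsto_coe). [difficulty:
provable-now] [BonettoLebowitzReyBellet2000]

TWO-LAYER PLAN. Foreseen glued splits once a crux moves (k ≤ 3, depth 1; nothing filed now):
HalfChainTailLaw ⇐ TailUpper (spreading bound + maximum principle 0 ≤ θ ≤ 1, contains SumRule) →
TailLower (conservation + Cauchy–Schwarz) → HalfChainTailLaw; DiffusiveCrossover ⇐ EarlyAgreement
(|θ_∞ − θ_N|(a₀N²) = o(1/N): far bath invisible at site 0 before the diffusive time) →
LateSaturation (N√a|θ_N(∞) − θ_N(aN²)| → 0 as a → ∞) → Signs (an absorbing far bath never makes the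
near boundary thermalise MORE) → DiffusiveCrossover; ResponseIdentity ⇐ GibbsKernelInvariance (=
BoundaryKernelBasics (a)) → FiniteResponseAtEquilibrium (resolvent form, cf. item 0717) →
ResponseIdentity.

KILL CRITERIA. (a) ¬SumRule (numerics: S_b(0) ≠ 2T²/γ for a long singly-driven chain, or a proof of
a residual ballistic channel at some lam, β > 0) kills HalfChainTailLaw and physically gives κ = ∞ —
file ¬HalfChainTailLaw, close `refuted:HalfChainTailLaw` and reconsider the conjunct; (b) a boundary
cusp exponent ≠ 1/2 (1 − θ_∞ ≍ t^{-α}, α ≠ 1/2) refutes Tail as stated (restate with α only if the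
conjunct survives, which for α < 1/2 it does not); (c) refutation of ResponseIdentity's FORMULA (not
mere non-existence of D_N) means the sign/normalisation bookkeeping is wrong — repairable by a
repaired item; (d) an oscillating (N−1)γE_N refutes only the import slot EscapeNonOscillation —
pivot to the fekete-resistance engine or a sharp-tail identification of κ_b; (e) FourierGreenKubo's
ThermodynamicLimit + GreenKubo proved elsewhere moots the route (close superseded).

NOT DECOMPOSED YET. The engines for Tail (diffusive spreading bound + maximum principle for the
upper side; conservation + Cauchy–Schwarz for the lower side), the three sub-statements of
Crossover, T-dependence of all constants (nothing is uniform as T → 0), the FP-identification lemma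
inside NessUnique, and any identification κ_b = πγ²A²/c_v (A = sharp tail amplitude) — deliberately
left to glued splits after a crux moves (D-0019).

CHEAPEST FALSIFIER. One long equilibrium MD run of a singly-thermostatted proxy of the half-line (M
= 4096 sites, one OU bath at T = 1, ω₂ = lam = β = γ = 1): estimate the power spectrum S_b(ω) of b =
p_0². The line dies if S_b(0) ≠ 2T²/γ within errors (¬SumRule ⇒ HalfChainTailLaw false and the
conjunct itself in danger), or if the low-frequency cusp exponent is not 1/2 (Tail false as stated).
Not run here (planner seat, hub compute-free); it is the refuter's first kit job. Lookup falsifier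
already done: the harmonic chain (lam = β = 0) fails exactly SumRule (RiederLebowitzLieb1967,
Nakazawa1970) and is excluded by the hypotheses lam, β > 0 — no degenerate-instance falsity (two
refuter route-reviews of the identical statements, 2026-08-15).

NUMBERS. S_b(0) = 2T²/γ (sum rule, exact if no ballistic channel); continuum shadow 1 − θ(0,t) ≈ √(κ
c_v/π)/(γ√t), so κ_b = πγ²A²/c_v if 1 − θ_∞(t) ∼ A t^{-1/2} (not claimed); harmonic L²-gap of the
N-chain ≍ N⁻³ (BeckerMenegaki2022 Thm 1); light cone N/v vs diffusive time ≍ N²; items at open: 11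
(1 target, 4 cruxes, 5 support, 1 assembly).

DEFINITION REQUESTS. None: pinnedChain, OscillatorChain.transitionKernel,
OscillatorChain.gibbsMeasure, OscillatorChain.totalCurrent, OscillatorChain.IsSteadyState,
PhaseSpace, pinnedChain_exists_isSteadyState all exist
(Literature.MathematicalPhysics.KineticTheory.HeatConduction, files FouriersLaw /
LangevinChainKernel / LangevinChainGibbs / LangevinChainNESSHolds); every decl elaborated in
Sketch3.lean (rc0).

Novelty: Searches (2026-08-15, this seat): `lit frontier AtomisticToContinuum --since 2021` (30 rows;
heat-conduction items: arXiv:2604.14056 Gautama–Khodabandehlou–Maes–Santra "Specific heat of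
thermally driven chains" — quasistatic excess-heat response of the boundary-driven HARMONIC chain,
read p.1; arXiv:2606.08839 Koide–Nicacio — harmonic networks, read p.1; arXiv:2310.13338
CanestrariLiveraniOlla2026; arXiv:2604.00777 harmonic chain + particle reservoir); `lit galaxy
search "semi-infinite anharmonic chain heat bath boundary temperature relaxation power law" --star
all` (0), `lit galaxy search "kinetic energy autocorrelation boundary oscillator heat bath" --star
all` (0), `lit galaxy search "Kapitza boundary resistance anharmonic chain Green-Kubo" --star pdf`
(0); `lit search` ×2 (searchd unavailable, rc 75); inherited from the card's two refuter audits and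
the retired route's review: crossref ×4, zbMATH, galaxy all/pdf, `lit read` arXiv:0809.4543 and
doi:10.1080/0026897031000068578 p.6, `lit search --hybrid "semi-infinite chain single heat bath
boundary temperature relaxation power law anharmonic"` (engineering books only).
Nearest prior art found: KunduDharNarayan2009 (arXiv:0809.4543: open-system Green–Kubo, response =
∫⟨J J_fp⟩ with J_fp = −(γ/2)(v_1² − T) — the identity D_N = (N−1)γE_N in substance);
BarratChiaruttini2003 (doi:10.1080/0026897031000068578: EMD contact conductance = T⁻²∫⟨q q(t)⟩ with
finite-size plateau-then-decay); the half-space effusivity law; SharmaEtAl202  [refs: 10.1080/0026897031000068578, 10.1080/0026897031000068578:, 2604.14056, 2606.08839, 2310.13338, 2604.00777, 0809.4543, 2405.00654, 2510.20003, doi:10.1080/0026897031000068578, CanestrariLiveraniOlla2026, KunduDharNarayan2009, BarratChiaruttini2003, SharmaEtAl2026]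

Barriers (technique_class: boundary-tail half-line-comparison fixed-N-linear-response): - technique_class: boundary-tail half-line-comparison fixed-N-linear-response
- Literature.Barriers.AtomisticToContinuum.HasBoundedResponse: APPLIES to ResponseIdentity, which is
fixed-N linear response (inside the class) and is used only at fixed N; the N-dependence is exported
to the N-free curve θ_∞ (HalfChainTailLaw) plus DiffusiveCrossover, which are NOT fixed-N statements
— met head-on by those two cruxes, not evaded; bounded response is an OUTPUT (Tail-upper +
Crossover-upper), cf. hasBoundedResponse_of_fouriersLawFor.
- Literature.Barriers.AtomisticToContinuum.MacroErgodicityBarrier: Tail and Crossover are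
hydrodynamic-scale statements and stand at the same wall as every diffusive argument; no
one-block/two-block estimate is formulated — the bet is that a ONE-boundary, time-integrated,
first-order quantity at a thermostatted site (hypoellipticity, OU structure, proved exponential
ergodicity at fixed N) needs less than bulk local equilibrium (comparison principles for 0 ≤ θ ≤ 1
replace block estimates). Honest: re-localised, not evaded.
- Literature.Barriers.AtomisticToContinuum.HarmonicChainBallisticFlux: at lam = β = 0 the sum rule
is DEFICIENT (θ_∞(∞) < 1, permanent inflow into a perfect phonon sink) and Tail-upper fails while
EscapeNonOscillation holds with limit ⊤ — the harmonic failure is detected by exactly one item; lam,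
β > 0 are hypotheses of every decl, consistent with not_fouriersLawFor_harmonic.
- Literature.Barriers.AtomisticToContinuum.Mazur1969_inequali

History (route lifecycle, newest last):
- 2026-08-24T07:54:37Z · DORMANT — reconciler: no traction for 6.6 d (last activity item-evidence-added at 2026-08-17T16:52:55Z); parked, not closed — `ledger route dormant route-AtomisticToConti (operator:999:2348916)

sub-problem: FouriersLaw · status: dormant · opened planner-plancard-AtomisticToContinuum-Fourier-bc4d78e9-g2-0 2026-08-15T18:51:45Z · rev 4 · ledger route-AtomisticToContinuum-BoundaryEscapeDeficit
GENERATED by the gate from the ledger (D-0016/17). Provers cite these decls: `theorem foo : Summit.AtomisticToContinuum.FouriersLaw.Theses.BoundaryEscapeDeficit.<Decl> := …` in Summits/AtomisticToContinuum/FouriersLaw/Theorems/<Name>.lean.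
-/

namespace Summit.AtomisticToContinuum.FouriersLaw.Theses.BoundaryEscapeDeficit

open scoped BigOperators Topology Manifold Classical MeasureTheory ProbabilityTheory Matrix InnerProductSpace ComplexConjugate ContinuousMap
open Filter Set Function TopologicalSpace MeasureTheory

attribute [summit_statement] _root_.FouriersLaw

/-- item stmt-AtomisticToContinuum-12234 · target · rank 0 · open · by planner
why it might fail: Inherits Tail, Crossover and the non-oscillation slot; κ_b > 0 finite is exactly normal conduction of the pinned anharmonic chain, open for every deterministic anharmonic bulk (BLR2000 §6.3).
sources: BonettoLebowitzReyBellet2000, KunduDharNarayan2009, arXiv:0809.4543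
[target] THE ESCAPE LAW X_b(E): for all parameters > 0 and T > 0 there is κ_b(T) > 0 with
(N−1)·γ·E_N → κ_b(T), E_N = 1 − (γ/T²)∫_0^∞ K_N the escape deficit of the N-chain (notation of §
Thesis). Follows from HalfChainTailLaw + DiffusiveCrossover + EscapeNonOscillation (support
EscapeLawOfCruxes; the argument is also inlined in `closes`); with NessUnique + ResponseIdentity it
gives FouriersLaw with κ = κ_b. -/
@[route_item "route-AtomisticToContinuum-BoundaryEscapeDeficit", crux]
def EscapeLaw : Prop :=
  ∀ ω₂ lam β γ : ℝ, 0 < ω₂ → 0 < lam → 0 < β → 0 < γ → ∀ T : ℝ, 0 < T → (let P := Literature.MathematicalPhysics.KineticTheory.HeatConduction.pinnedChain ω₂ lam β γ; let K : ℕ → ℝ → ℝ := fun N u => if h : 0 < N then ∫ z, ((z.2 ⟨0, h⟩) ^ 2 - T) * (∫ y, ((y.2 ⟨0, h⟩) ^ 2 - T) ∂(P.transitionKernel N T T u.toNNReal z)) ∂(P.gibbsMeasure N T) else 0; let E : ℕ → ℝ := fun N => 1 - γ / T ^ 2 * ∫ u in Set.Ioi (0 : ℝ), K N u; ∃ κb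 : ℝ, 0 < κb ∧ Filter.Tendsto (fun N : ℕ => ((N : ℝ) - 1) * γ * E N) Filter.atTop (nhds κb))

/-- item stmt-AtomisticToContinuum-12235 · crux · rank 2 · open · by planner
why it might fail: Two-sided diffusive law for one boundary scalar of a Hamiltonian half-line at all T>0: upper = diffusive spreading bound (exists for no anharmonic chain, BLR2000 §6.3), lower = no superdiffusive escape; as T→0 near-harmonic (θ_∞(∞)<1, RLL1967): c,C,t₀ degenerate; breathers may trap energy.
sources: BonettoLebowitzReyBellet2000, RiederLebowitzLieb1967, Nakazawa1970, LepriLiviPoliti2003, Dhar2008, arXiv:2510.20003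
[crux] HALF-LINE BOUNDARY TAIL LAW (card: TAIL). ∃ c, C, t₀ > 0: for every t ≥ t₀, eventually in the
length M, c/√t ≤ 1 − θ_M(t) ≤ C/√t, θ_M(t) = (γ/T²)∫_0^t K_M. Reading: 1 − θ_∞(t) = J(t)/(γδ) is the
normalised energy inflow still entering a half-infinite chain a time t after its single bath was
raised by δ. Upper = complete boundary thermalisation (sum rule (γ/T²)∫_0^∞ K_∞ = 1: no ballistic
channel — FALSE for the harmonic chain) at no slower than the diffusive rate; lower = energy not
carried away faster than diffusively (first-return exponent; √|ω| cusp of S_b at 0, S_b(0) = 2T²/γ).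
Shadows: Robin half-space 1 − θ(0,t) ≈ √(κc_v/π)/(γ√t); SSEP half-line with one reservoir.
[difficulty: open-problem] -/
@[route_item "route-AtomisticToContinuum-BoundaryEscapeDeficit", crux]
def HalfChainTailLaw : Prop :=
  ∀ ω₂ lam β γ : ℝ, 0 < ω₂ → 0 < lam → 0 < β → 0 < γ → ∀ T : ℝ, 0 < T → (let P := Literature.MathematicalPhysics.KineticTheory.HeatConduction.pinnedChain ω₂ lam β γ; let K : ℕ → ℝ → ℝ := fun N u => if h : 0 < N then ∫ z, ((z.2 ⟨0, h⟩) ^ 2 - T) * (∫ y, ((y.2 ⟨0, h⟩) ^ 2 - T) ∂(P.transitionKernel N T T u.toNNReal z)) ∂(P.gibbsMeasure N T) else 0; let θ : ℕ → ℝ → ℝ := fun N t => γ / T ^ 2 * ∫ u in (0 : ℝ)..t, K N u; ∃ c C t₀ : ℝ, 0 < c ∧ 0 < t₀ ∧ ∀ t : ℝ, t₀ ≤ t → ∀ᶠ M : ℕ in Filter.atTop, c / Real.sqrt t ≤ 1 - θ M t ∧ 1 - θ M t ≤ C / Real.sqrt t)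

/-- item stmt-AtomisticToContinuum-12236 · crux · rank 3 · open · by planner
why it might fail: Needs the far bath invisible at site 0 before the diffusive time to O(1/N), saturation after it (decay rate ≳1/N² of ONE autocorrelation; the harmonic L²-gap is N⁻³, Becker–Menegaki 2022) and sign control of K_N at kinetic times — all beyond the light cone N/v.
sources: BeckerMenegaki2022, KunduDharNarayan2009, BarratChiaruttini2003, BonettoLebowitzReyBellet2000, ButtaEtAl2007, Dhar2008
[crux] DIFFUSIVE CROSSOVER (card: CROSSOVER, made well-posed). ∃ a₀, a₁, c₂ > 0, C₂: for all large
N, eventually in M, c₂(1 − θ_M(a₁N²)) ≤ E_N ≤ C₂(1 − θ_M(a₀N²)). Reading: by the sum rule E_N =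
(γ/T²)∫_0^∞(K_∞ − K_N) is the part of a spontaneous boundary energy fluctuation that, in the
N-chain, leaves through the FAR bath instead of returning; the claim: it is comparable to what the
half-line still retains at times ≍ N². With HalfChainTailLaw at t = a_iN²: c ≤ N·E_N ≤ C (bounded
response AND an Ohmic lower bound). [deps: HalfChainTailLaw] [difficulty: open-problem] -/
@[route_item "route-AtomisticToContinuum-BoundaryEscapeDeficit", crux]
def DiffusiveCrossover : Prop :=
  ∀ ω₂ lam β γ : ℝ, 0 < ω₂ → 0 < lam → 0 < β → 0 < γ → ∀ T : ℝ, 0 < T → (let P := Literature.MathematicalPhysics.KineticTheory.HeatConduction.pinnedChain ω₂ lam β γ; let K : ℕ → ℝ → ℝ := fun N u => if h : 0 < N then ∫ z, ((z.2 ⟨0, h⟩) ^ 2 - T) * (∫ y, ((y.2 ⟨0, h⟩) ^ 2 - T) ∂(P.transitionKernel N T T u.toNNReal z)) ∂(P.gibbsMeasure N T) else 0; let θ : ℕ → ℝ → ℝ := fun N t => γ / T ^ 2 * ∫ u in (0 : ℝ)..t, K N u; let E : ℕ → ℝ := fun N => 1 - γ / T ^ 2 * ∫ u in Set.Ioi (0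 : ℝ), K N u; ∃ a₀ a₁ c₂ C₂ : ℝ, 0 < a₀ ∧ 0 < a₁ ∧ 0 < c₂ ∧ ∀ᶠ N : ℕ in Filter.atTop, ∀ᶠ M : ℕ in Filter.atTop, c₂ * (1 - θ M (a₁ * (N : ℝ) ^ 2)) ≤ E N ∧ E N ≤ C₂ * (1 - θ M (a₀ * (N : ℝ) ^ 2)))

/-- item stmt-AtomisticToContinuum-12237 · crux · rank 4 · closed · proved by Summit.AtomisticToContinuum.FouriersLaw.Cruxes.SuperadditiveResistance.ThermaliseThenCutProbeInsertion.responseIdentity_proof (prover) · by planner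
why it might fail: Finite-N linear response at equilibrium (δ-differentiability of the NESS current) is unproved for the Langevin pinned chain (Hairer–Majda 2009 Assumption 5 fails; item 0717 open); also needs Gibbs = invariant law of the constructed kernels and J̃=γ(T_L−⟨p_0²⟩) in the weak class.
sources: KunduDharNarayan2009, arXiv:0809.4543, ReyBellet2003, arXiv:0909.4313, BonettoLebowitzReyBellet2000, CuneoEckmannHairerReyBellet2018
[crux] RESPONSE IDENTITY D_N = (N−1)·γ·E_N (card: ResponseIdentities). Parameters > 0; ASSUMING
uniqueness of weak steady states (hypothesis = NessUnique): for every steady-state family μ, T > 0,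
N ≥ 1, K_N ∈ L¹(0,∞) and totalCurrent(μ N (T+δ/2) (T−δ/2))/δ → (N−1)γE_N as δ → 0, δ ≠ 0 (existence
AND value; N = 1: both sides 0). Derivation (re-derived by two refuter reviews): totalCurrent =
(N−1)J̃; J̃ = γ(T_L − ⟨p_0²⟩_μ); response of ⟨p_0²⟩ by Gaussian integration by parts ∂_{T_b}L =
γ∂²_{p_b}, ∫∂²_{p_b}f dμ_T = T⁻²∫f(p_b² − T)dμ_T; for the symmetric driving the cross kernel is E_N
by the sum-to-one identity (equal-temperature shift keeps Gibbs): dJ̃/dδ = γE_N. Real content: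
finite-N linear response at equilibrium for the hypoelliptic chain; Gibbs invariance of the
constructed kernels; K_N ∈ L¹ from the proved exponential ergodicity. [deps: NessUnique,
BoundaryKernelBasics] [difficulty: L] -/
@[route_item "route-AtomisticToContinuum-BoundaryEscapeDeficit", crux]
def ResponseIdentity : Prop :=
  ∀ ω₂ lam β γ : ℝ, 0 < ω₂ → 0 < lam → 0 < β → 0 < γ → (∀ (N : ℕ) (T_L T_R : ℝ), 0 < T_L → 0 < T_R → ∀ μ ν : MeasureTheory.Measure (Literature.MathematicalPhysics.KineticTheory.HeatConduction.PhaseSpace N), (Literature.MathematicalPhysics.KineticTheory.HeatConduction.pinnedChain ω₂ lam β γ).IsSteadyState N T_L T_R μ → (Literature.MathematicalPhysics.KineticTheory.HeatConduction.pinnedChain ω₂ lam β γ).IsSteadyState N T_L T_R ν → μ = ν) → ∀ μ : (N : ℕ) → ℝ → ℝ → MeasureTheory.Measure (Literature.MathematicalPhysics.KineticTheory.HeatConduction.PhaseSpace N), (∀ (N : ℕ) (T_L T_R : ℝ), 0 < T_L → 0 < T_R → (Literature.MathematicalPhysics.KineticTheory.HeatConduction.pinnedChain ω₂ lam β γ).IsSteadyState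 N T_L T_R (μ N T_L T_R)) → ∀ T : ℝ, 0 < T → (let P := Literature.MathematicalPhysics.KineticTheory.HeatConduction.pinnedChain ω₂ lam β γ; let K : ℕ → ℝ → ℝ := fun N u => if h : 0 < N then ∫ z, ((z.2 ⟨0, h⟩) ^ 2 - T) * (∫ y, ((y.2 ⟨0, h⟩) ^ 2 - T) ∂(P.transitionKernel N T T u.toNNReal z)) ∂(P.gibbsMeasure N T) else 0; let E : ℕ → ℝ := fun N => 1 - γ / T ^ 2 * ∫ u in Set.Ioi (0 : ℝ), K N u; ∀ N : ℕ, 0 < N → MeasureTheory.IntegrableOn (K N) (Set.Ioi 0) ∧ Filter.Tendsto (fun δ : ℝ => P.totalCurrent (μ N (T + δ / 2) (T - δ / 2)) / δ) (nhdsWithin 0 {(0 : ℝ)}ᶜ) (nhds (((N : ℝ) - 1) * γ * E N)))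

/-- item stmt-AtomisticToContinuum-12238 · crux · rank 5 · open · by planner
why it might fail: Bare regularity of N↦(N−1)γE_N; expected from resistance quasi-subadditivity (fekete card) or monotone saturation, neither proved; parity/commensurability oscillations of the conductance in N at low T (near-integrable corner) would refute it while the Ohmic bracket survives.
sources: BonettoLebowitzReyBellet2000, arXiv:2310.13338, CanestrariLiveraniOlla2026
[crux] NON-OSCILLATION OF THE ESCAPE DEFICIT (import slot, lowest rank): the real sequence
(N−1)·γ·E_N has a limit in EReal = [−∞, ∞] (liminf = limsup; no value claimed) — the minimal
'existence of the limit' ingredient of BLR (33) that the boundary mechanism does not produce by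
itself (Tail + Crossover give only c ≤ (N−1)γE_N ≤ C); stated in EReal so that BOTH halves of the
bracket stay load-bearing (for the harmonic chain it holds with limit ⊤ while Tail-upper fails).
Expected engines: quasi-subadditivity of the resistance 1/(γE_N) (card
fekete-resistance-subadditivity) or monotone saturation of N ↦ N·E_N. Provers of THIS route should
not start here. [difficulty: L] -/
@[route_item "route-AtomisticToContinuum-BoundaryEscapeDeficit", crux]
def EscapeNonOscillation : Prop :=
  ∀ ω₂ lam β γ : ℝ, 0 < ω₂ → 0 < lam → 0 < β → 0 < γ → ∀ T : ℝ, 0 < T → (let P := Literature.MathematicalPhysics.KineticTheory.HeatConduction.pinnedChain ω₂ lam β γ; let K : ℕ → ℝ → ℝ := fun N u => if h : 0 < N then ∫ z, ((z.2 ⟨0, h⟩) ^ 2 - T) * (∫ y, ((y.2 ⟨0, h⟩) ^ 2 - T) ∂(P.transitionKernel N T T u.toNNReal z)) ∂(P.gibbsMeasure N T) else 0; let E : ℕ → ℝ := fun N => 1 - γ / T ^ 2 * ∫ u in Set.Ioi (0 : ℝ), K N u; ∃ ℓ : EReal, Filter.Tendsto (fun N : ℕ => ((((N : ℝ) - 1)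 * γ * E N : ℝ) : EReal)) Filter.atTop (nhds ℓ))

/-- item stmt-AtomisticToContinuum-0741 · support · rank 9 · closed · proved by Summit.AtomisticToContinuum.FouriersLaw.Theorems.nessUnique_proof (prover) · by planner
sources: CuneoEckmannHairerReyBellet2018, Carmona2007
[crux] UNIQUENESS OF THE WEAK STEADY STATE (the half of stmt-0706 not covered by the landed fact
Literature.MathematicalPhysics.KineticTheory.HeatConduction.CuneoEckmannHairerReyBellet2018_pinnedChain,
p3544): for pinnedChain ω₂ lam β γ (all > 0), every N and T_L, T_R > 0, any two measures in the weak
Fokker–Planck class IsSteadyState (probability, ∫ L f dμ = 0 for f ∈ C_c^∞, bond currents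
integrable) coincide. Print: uniqueness of the INVARIANT MEASURE of the Langevin semigroup
(CuneoEckmannHairerReyBellet2018 Thm 2.13(1): C1, C2, CA; Carmona2007 Thm 1.1(iii)); the item
additionally needs 'weak stationary probability solution of L*μ = 0 ⇒ P_t-invariant' for this
hypoelliptic L with cubic drift (Echeverría 1982 well-posed martingale problem on C_c^∞ +
non-explosion via e^{θH}; Bogachev–Krylov–Röckner–Shaposhnikov 2015 Ch. 5 is non-degenerate only) —
the FP-identification lemma is the formal crux. N = 0: PhaseSpace 0 is a point (unique probability
measure); N = 1: both baths on site 0, OU at temperature (T_L+T_R)/2. This is exactly the hypothesis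
of FiniteResponse and ThermodynamicLimit and, with the fact, gives clause (i) of FouriersLawFor. -/
@[route_item "route-AtomisticToContinuum-BoundaryEscapeDeficit", crux]
def NessUnique : Prop :=
  ∀ ω₂ lam β γ : ℝ, 0 < ω₂ → 0 < lam → 0 < β → 0 < γ → ∀ (N : ℕ) (T_L T_R : ℝ), 0 < T_L → 0 < T_R → ∀ μ ν : MeasureTheory.Measure (Literature.MathematicalPhysics.KineticTheory.HeatConduction.PhaseSpace N), (Literature.MathematicalPhysics.KineticTheory.HeatConduction.pinnedChain ω₂ lam β γ).IsSteadyState N T_L T_R μ → (Literature.MathematicalPhysics.KineticTheory.HeatConduction.pinnedChain ω₂ lam β γ).IsSteadyState N T_L T_R ν → μ = ν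

/-- `NessUnique` holds: proved by `Summit.AtomisticToContinuum.FouriersLaw.Theorems.nessUnique_proof`. -/
theorem NessUnique_holds : NessUnique := _root_.Summit.AtomisticToContinuum.FouriersLaw.Theorems.nessUnique_proof

/-- item stmt-AtomisticToContinuum-12239 · support · rank 9 · closed · proved by Summit.AtomisticToContinuum.FouriersLaw.Theorems.SubdiffusiveBondHeat.boundaryKernelBasics_proof (prover) · by planner
sources: CuneoEckmannHairerReyBellet2018
[support] BASICS OF THE BOUNDARY KERNEL at fixed N ≥ 1, T > 0 (warm-up that de-junks θ and E): (a)
the Gibbs measure is invariant for the constructed kernels at equal bath temperatures, (gibbsMeasure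
N T).bind (transitionKernel N T T t) = gibbsMeasure N T (weak stationarity
pinnedChain_isSteadyState_gibbsMeasure is proved; kernel invariance is Dynkin + forward-equation
uniqueness, or Itô on the pathwise solution); (b) u ↦ K_N(u) continuous; (c) |K_N(u)| ≤ 2T² =
Var(p_0²); (d) |K_N(u)| ≤ C e^{−cu} from the proved exponential ergodicity; (e) hence K_N ∈ L¹(0,∞).
[difficulty: M] -/
@[route_item "route-AtomisticToContinuum-BoundaryEscapeDeficit"]
def BoundaryKernelBasics : Prop :=
  ∀ ω₂ lam β γ : ℝ, 0 < ω₂ → 0 < lam → 0 < β → 0 < γ → ∀ T : ℝ, 0 < T → ∀ N : ℕ, 0 < N → (let P := Literature.MathematicalPhysics.KineticTheory.HeatConduction.pinnedChain ω₂ lam β γ; let K : ℕ → ℝ → ℝ := fun N u => if h : 0 < N then ∫ z, ((z.2 ⟨0, h⟩) ^ 2 - T) * (∫ y, ((y.2 ⟨0, h⟩) ^ 2 - T) ∂(P.transitionKernel N T T u.toNNReal z)) ∂(P.gibbsMeasure N T) else 0; (∀ t : NNReal, (P.gibbsMeasure N T).bind (P.transitionKernel N T T t) = P.gibbsMeasure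 N T) ∧ Continuous (K N) ∧ (∀ u : ℝ, |K N u| ≤ 2 * T ^ 2) ∧ (∃ C c : ℝ, 0 < c ∧ ∀ u : ℝ, 0 ≤ u → |K N u| ≤ C * Real.exp (-c * u)) ∧ MeasureTheory.IntegrableOn (K N) (Set.Ioi 0))

/-- item stmt-AtomisticToContinuum-12240 · support · rank 9 · open · by planner
sources: ButtaEtAl2007, LanfordLebowitzLieb1977
[support] EXISTENCE OF THE HALF-LINE BOUNDARY CURVE θ_∞(t) := lim_{M→∞} θ_M(t) for every t ≥ 0
(makes 'half-infinite chain with one bath' an honest object; NOT used by `closes`, whose cruxes are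
stated eventually-in-M): finite-time locality of the Langevin/Hamiltonian dynamics with quartic
forces (Marchioro–Pellegrinotti–Pulvirenti type bounds, ButtaEtAl2007) + convergence of the 1-D
Gibbs marginals near site 0 as M → ∞ (transfer-operator gap) + |K_M| ≤ 2T² for dominated convergence
in u. [difficulty: M] -/
@[route_item "route-AtomisticToContinuum-BoundaryEscapeDeficit"]
def HalfChainLocality : Prop :=
  ∀ ω₂ lam β γ : ℝ, 0 < ω₂ → 0 < lam → 0 < β → 0 < γ → ∀ T : ℝ, 0 < T → (let P := Literature.MathematicalPhysics.KineticTheory.HeatConduction.pinnedChain ω₂ lam β γ; let K : ℕ → ℝ → ℝ := fun N u => if h : 0 < N then ∫ z, ((z.2 ⟨0, h⟩) ^ 2 - T) * (∫ y, ((y.2 ⟨0, h⟩) ^ 2 - T) ∂(P.transitionKernel N T T u.toNNReal z)) ∂(P.gibbsMeasure N T) else 0; let θ : ℕ → ℝ → ℝ := fun N t => γ / T ^ 2 * ∫ u in (0 : ℝ)..t, K N u; ∀ t : ℝ, 0 ≤ t → ∃ θinf : ℝ, Filter.Tendsto (fun M : ℕ => θ M t) Filter.atTop (nhds θinf))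

/-- item stmt-AtomisticToContinuum-12241 · support · rank 9 · open · by planner
sources: RiederLebowitzLieb1967, Nakazawa1970, Mazur1969, LepriLiviPoliti2003
[support] SUM RULE / complete boundary thermalisation of the half-line (milestone ⊂
HalfChainTailLaw-upper; the route's CHEAPEST KILL TEST): ∀ ε > 0 ∃ t₀ ∀ t ≥ t₀, eventually in M, |1
− θ_M(t)| ≤ ε, i.e. lim_t lim_M θ_M(t) = 1 = (γ/T²)∫_0^∞ K_∞: a half-infinite chain whose single
bath is raised by δ eventually shows ⟨p_0²⟩ = T + δ to first order ⇔ no ballistic channel. FALSE for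
the harmonic chain (permanent inflow into a perfect phonon sink: the orders lim_t, lim_M do not
commute), so lam, β > 0 must enter here. [difficulty: L] -/
@[route_item "route-AtomisticToContinuum-BoundaryEscapeDeficit"]
def SumRule : Prop :=
  ∀ ω₂ lam β γ : ℝ, 0 < ω₂ → 0 < lam → 0 < β → 0 < γ → ∀ T : ℝ, 0 < T → (let P := Literature.MathematicalPhysics.KineticTheory.HeatConduction.pinnedChain ω₂ lam β γ; let K : ℕ → ℝ → ℝ := fun N u => if h : 0 < N then ∫ z, ((z.2 ⟨0, h⟩) ^ 2 - T) * (∫ y, ((y.2 ⟨0, h⟩) ^ 2 - T) ∂(P.transitionKernel N T T u.toNNReal z)) ∂(P.gibbsMeasure N T) else 0; let θ : ℕ → ℝ → ℝ := fun N t => γ / T ^ 2 * ∫ u in (0 : ℝ)..t, K N u; ∀ ε : ℝ, 0 < ε → ∃ t₀ : ℝ, ∀ t : ℝ, t₀ ≤ t → ∀ᶠ M : ℕ in Filter.atTop, |1 - θ M t| ≤ ε)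

/-- item stmt-AtomisticToContinuum-12242 · support · rank 9 · closed · proved by Summit.AtomisticToContinuum.FouriersLaw.Theorems.escapeLawOfCruxes_proof (prover) · by planner
sources: BonettoLebowitzReyBellet2000
[support] MESH of the second layer (provable now — a sorry-free proof `escapeLawOfCruxes_holds`
exists in the planner's Sketch2.lean and the same argument is inlined in `closes`): Tail at t =
a₁N², a₀N² and Crossover (pick one common witness M of the three `∀ᶠ M` filters) bracket γc₂c/(2√a₁)
≤ (N−1)γE_N ≤ γ·max(C₂,0)·C/√a₀ for large N; the EReal limit is then real and positive
(ge_of_tendsto/le_of_tendsto, EReal.coe_toReal, EReal.tendsto_coe). [difficulty: provable-now] -/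
@[route_item "route-AtomisticToContinuum-BoundaryEscapeDeficit"]
def EscapeLawOfCruxes : Prop :=
  HalfChainTailLaw → DiffusiveCrossover → EscapeNonOscillation → EscapeLaw

/-- item stmt-AtomisticToContinuum-12243 · assembly · rank 1 · closed · proved by Summit.AtomisticToContinuum.FouriersLaw.Theorems.boundaryEscapeDeficit_assembly_proof @ 5cf54cb371cc (prover) · by planner
sources: BonettoLebowitzReyBellet2000
[assembly] NessUnique → ResponseIdentity → HalfChainTailLaw → DiffusiveCrossover →
EscapeNonOscillation → FouriersLaw (the type of `closes`, curried). -/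
@[route_item "route-AtomisticToContinuum-BoundaryEscapeDeficit"]
def Assembly : Prop :=
  NessUnique → ResponseIdentity → HalfChainTailLaw → DiffusiveCrossover → EscapeNonOscillation → _root_.FouriersLaw

/-! D-0027 §2.1 — DECIDING THEOREM (planner-authored via `route open/edit --closes-file`; by planner-plancard-AtomisticToContinuum-Fourier-bc4d78e9-g2-0 2026-08-15T19:04:18Z):
its hypotheses are this route's items and its conclusion the sub-problem Statement (glue_lint), and it elaborates with this file. -/

@[closes "route-AtomisticToContinuum-BoundaryEscapeDeficit"] theorem closes (hNU : NessUnique) (hRI : ResponseIdentity)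
    (hT : HalfChainTailLaw) (hC : DiffusiveCrossover) (hNO : EscapeNonOscillation) :
    _root_.FouriersLaw := by
  -- (0) ABSTRACT MESH LEMMA (pure real analysis; = support item EscapeLawOfCruxes in abstract form):
  --     an eventual two-sided bracket L ≤ (N-1)·γ·E_N ≤ U (L > 0) from Tail at t = a₁N², a₀N² and
  --     Crossover, then the EReal non-oscillation limit is real and ≥ L > 0.
  have key : ∀ (E : ℕ → ℝ) (θ : ℕ → ℝ → ℝ) (γ c C t₀ a₀ a₁ c₂ C₂ : ℝ),
      0 < γ → 0 < c → 0 < a₀ → 0 < a₁ → 0 < c₂ →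
      (∀ t : ℝ, t₀ ≤ t → ∀ᶠ M : ℕ in Filter.atTop,
        c / Real.sqrt t ≤ 1 - θ M t ∧ 1 - θ M t ≤ C / Real.sqrt t) →
      (∀ᶠ N : ℕ in Filter.atTop, ∀ᶠ M : ℕ in Filter.atTop,
        c₂ * (1 - θ M (a₁ * (N : ℝ) ^ 2)) ≤ E N ∧ E N ≤ C₂ * (1 - θ M (a₀ * (N : ℝ) ^ 2))) →
      (∃ ℓ : EReal, Filter.Tendsto (fun N : ℕ => ((((N : ℝ) - 1) * γ * E N : ℝ) : EReal))
        Filter.atTop (nhds ℓ)) →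
      ∃ κb : ℝ, 0 < κb ∧
        Filter.Tendsto (fun N : ℕ => ((N : ℝ) - 1) * γ * E N) Filter.atTop (nhds κb) := by
    intro E θ γ c C t₀ a₀ a₁ c₂ C₂ hγ hc ha₀ ha₁ hc₂ hTail hCross hNO'
    obtain ⟨ℓ, hℓ⟩ := hNO'
    have hsa₁ : 0 < Real.sqrt a₁ := Real.sqrt_pos.2 ha₁
    have hsa₀ : 0 < Real.sqrt a₀ := Real.sqrt_pos.2 ha₀
    -- Step 1: the eventual bracket.
    have hbounds : ∀ᶠ N : ℕ in Filter.atTop,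
        γ * c₂ * c / (2 * Real.sqrt a₁) ≤ ((N : ℝ) - 1) * γ * E N ∧
          ((N : ℝ) - 1) * γ * E N ≤ γ * max C₂ 0 * C / Real.sqrt a₀ := by
      have hN2 : ∀ᶠ N : ℕ in Filter.atTop, (2 : ℝ) ≤ N := by
        filter_upwards [Filter.eventually_ge_atTop 2] with N hN
        exact_mod_cast hN
      have hsq : Filter.Tendsto (fun N : ℕ => (N : ℝ) ^ 2) Filter.atTop Filter.atTop :=
        (tendsto_pow_atTop two_ne_zero).comp tendsto_natCast_atTop_atTop
      have ht1 : ∀ᶠ N : ℕ in Filter.atTop, t₀ ≤ a₁ * (N : ℝ) ^ 2 :=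
        (Filter.Tendsto.const_mul_atTop ha₁ hsq).eventually_ge_atTop t₀
      have ht0 : ∀ᶠ N : ℕ in Filter.atTop, t₀ ≤ a₀ * (N : ℝ) ^ 2 :=
        (Filter.Tendsto.const_mul_atTop ha₀ hsq).eventually_ge_atTop t₀
      filter_upwards [hN2, ht1, ht0, hCross] with N hN h1 h0 hX
      have hNpos : (0 : ℝ) < N := by linarith
      -- one common witness M of the three `∀ᶠ M` statements
      obtain ⟨M, hM1, hM0, hMX⟩ := ((hTail _ h1).and ((hTail _ h0).and hX)).exists
      have hsq1 : Real.sqrt (a₁ * (N : ℝ) ^ 2) = Real.sqrt a₁ * N := by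
        rw [Real.sqrt_mul ha₁.le, Real.sqrt_sq hNpos.le]
      have hsq0 : Real.sqrt (a₀ * (N : ℝ) ^ 2) = Real.sqrt a₀ * N := by
        rw [Real.sqrt_mul ha₀.le, Real.sqrt_sq hNpos.le]
      rw [hsq1] at hM1
      rw [hsq0] at hM0
      have hElow : c₂ * (c / (Real.sqrt a₁ * N)) ≤ E N :=
        le_trans (mul_le_mul_of_nonneg_left hM1.1 hc₂.le) hMX.1
      have hEnn : 0 ≤ E N := le_trans (by positivity) hElow
      have hy : 0 ≤ 1 - θ M (a₀ * (N : ℝ) ^ 2) := le_trans (by positivity) hM0.1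
      have hEup : E N ≤ max C₂ 0 * (C / (Real.sqrt a₀ * N)) :=
        le_trans hMX.2 (le_trans (mul_le_mul_of_nonneg_right (le_max_left _ _) hy)
          (mul_le_mul_of_nonneg_left hM0.2 (le_max_right _ _)))
      constructor
      · have hN1 : (N : ℝ) / 2 ≤ (N : ℝ) - 1 := by linarith
        have hfac : 0 ≤ γ * (c₂ * (c / (Real.sqrt a₁ * N))) := by positivity
        calc γ * c₂ * c / (2 * Real.sqrt a₁)
            = (N : ℝ) / 2 * (γ * (c₂ * (c / (Real.sqrt a₁ * N)))) := by
              field_simp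
          _ ≤ ((N : ℝ) - 1) * (γ * (c₂ * (c / (Real.sqrt a₁ * N)))) :=
              mul_le_mul_of_nonneg_right hN1 hfac
          _ = ((N : ℝ) - 1) * γ * (c₂ * (c / (Real.sqrt a₁ * N))) := by ring
          _ ≤ ((N : ℝ) - 1) * γ * E N :=
              mul_le_mul_of_nonneg_left hElow (by nlinarith)
      · have hγE : 0 ≤ γ * E N := mul_nonneg hγ.le hEnn
        calc ((N : ℝ) - 1) * γ * E N ≤ (N : ℝ) * γ * E N := by nlinarith
          _ ≤ (N : ℝ) * γ * (max C₂ 0 * (C / (Real.sqrt a₀ * N))) :=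
              mul_le_mul_of_nonneg_left hEup (by positivity)
          _ = γ * max C₂ 0 * C / Real.sqrt a₀ := by
              field_simp
    -- Step 2: squeeze the EReal limit into [L, U]; it is real, ≥ L > 0, and is the real limit.
    have hLpos : 0 < γ * c₂ * c / (2 * Real.sqrt a₁) := by positivity
    have hℓ_ge : ((γ * c₂ * c / (2 * Real.sqrt a₁) : ℝ) : EReal) ≤ ℓ :=
      ge_of_tendsto hℓ (hbounds.mono fun N h => EReal.coe_le_coe_iff.2 h.1)
    have hℓ_le : ℓ ≤ ((γ * max C₂ 0 * C / Real.sqrt a₀ : ℝ) : EReal) :=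
      le_of_tendsto hℓ (hbounds.mono fun N h => EReal.coe_le_coe_iff.2 h.2)
    have hℓ_top : ℓ ≠ ⊤ := ne_top_of_le_ne_top (EReal.coe_ne_top _) hℓ_le
    have hℓ_bot : ℓ ≠ ⊥ := ne_bot_of_le_ne_bot (EReal.coe_ne_bot _) hℓ_ge
    refine ⟨ℓ.toReal, ?_, ?_⟩
    · rw [← EReal.coe_toReal hℓ_top hℓ_bot, EReal.coe_le_coe_iff] at hℓ_ge
      exact lt_of_lt_of_le hLpos hℓ_ge
    · rw [← EReal.coe_toReal hℓ_top hℓ_bot] at hℓ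
      exact EReal.tendsto_coe.1 hℓ
  -- (1) SECOND LAYER: the three analytic cruxes give the escape law X_b(E) (item EscapeLaw).
  have hEL : EscapeLaw := by
    intro ω₂ lam β γ hω hl hβ hγ T hT0
    have h1 := hT ω₂ lam β γ hω hl hβ hγ T hT0
    have h2 := hC ω₂ lam β γ hω hl hβ hγ T hT0
    have h3 := hNO ω₂ lam β γ hω hl hβ hγ T hT0
    dsimp only at h1 h2 h3 ⊢
    obtain ⟨c, C, t₀, hc, -, hTail⟩ := h1
    obtain ⟨a₀, a₁, c₂, C₂, ha₀, ha₁, hc₂, hCross⟩ := h2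
    exact key _ _ γ c C t₀ a₀ a₁ c₂ C₂ hγ hc ha₀ ha₁ hc₂ hTail hCross h3
  -- (2) FIRST LAYER: FouriersLaw = ∀ parameters > 0, FouriersLawFor (pinnedChain …) = (i) ∧ (ii).
  intro ω₂ lam β γ hω hl hβ hγ
  have huniq := hNU ω₂ lam β γ hω hl hβ hγ
  refine ⟨?_, ?_⟩
  · -- clause (i): existence = LANDED theorem `pinnedChain_exists_isSteadyState` (CEHR 2018 Thm 2.13, all N,
    -- N = 0 included); uniqueness = item NessUnique.
    intro N T_L T_R hL hR
    obtain ⟨μ, hμ⟩ :=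
      Literature.MathematicalPhysics.KineticTheory.HeatConduction.pinnedChain_exists_isSteadyState hω hl hβ hγ N hL hR
    exact ⟨μ, hμ, fun ν hν => huniq N T_L T_R hL hR ν μ hν hμ⟩
  · -- clause (ii): κ T := κ_b(T), the escape-law limit, for T > 0 (1 otherwise); for a steady-state family
    -- D N := limUnder over 𝓝[≠] 0 of the response quotient: it IS the quotient's limit (N = 0: the empty
    -- chain carries no current; N ≥ 1: item ResponseIdentity), and D N = (N-1)·γ·E_N for N ≥ 1
    -- (uniqueness of limits), so D → κ_b(T) by the escape law.
    have hE := hEL ω₂ lam β γ hω hl hβ hγ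
    dsimp only at hE
    classical
    refine ⟨fun T => if hT : 0 < T then Classical.choose (hE T hT) else 1, ?_, ?_⟩
    · intro T hT
      simp only [dif_pos hT]
      exact (Classical.choose_spec (hE T hT)).1
    · intro μ hμ T hT
      have hR := hRI ω₂ lam β γ hω hl hβ hγ huniq μ hμ T hT
      dsimp only at hR
      have hlim := (Classical.choose_spec (hE T hT)).2
      simp only [dif_pos hT]
      refine ⟨fun N => limUnder (nhdsWithin (0 : ℝ) {(0 : ℝ)}ᶜ) (fun δ : ℝ =>
          (Literature.MathematicalPhysics.KineticTheory.HeatConduction.pinnedChain ω₂ lam β γ).totalCurrent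
            (μ N (T + δ / 2) (T - δ / 2)) / δ), ?_, ?_⟩
      · intro N
        rcases Nat.eq_zero_or_pos N with rfl | hN
        · simp only [Literature.MathematicalPhysics.KineticTheory.HeatConduction.OscillatorChain.totalCurrent_zero,
            zero_div]
          exact tendsto_nhds_limUnder ⟨0, tendsto_const_nhds⟩
        · exact tendsto_nhds_limUnder ⟨_, (hR N hN).2⟩
      · refine hlim.congr' ?_
        filter_upwards [Filter.eventually_gt_atTop 0] with N hN
        exact ((hR N hN).2.limUnder_eq).symm

end Summit.AtomisticToContinuum.FouriersLaw.Theses.BoundaryEscapeDeficit
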